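import Literature.Analysis.SpecialFunctions.RiemannThetaLevelThree
import HarnessLib

/-!
# Riemann theta functions with characteristics

For a `g × g` complex matrix `Ω` (symmetric with `Im Ω > 0`: a point of the Siegel upper half
space `𝔥_g`), vectors `a b ∈ ℂ^g` (the *characteristic* `[a; b]`, classically real or rational)
and `z ∈ ℂ^g`, the **Riemann theta function with characteristic `[a; b]`** is

  `ϑ[a; b](z, Ω) = Σ_{m ∈ ℤ^g} exp(πi ᵗ(m + a) Ω (m + a) + 2πi ᵗ(m + a)(z + b))`

(Lange, *Abelian Varieties over the Complex Numbers* = the held copy keyed `LangeBirkenhake1992`,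
§3.3.2 formula (3.10), PDF p. 172; Mumford, *Tata Lectures on Theta I*, Ch. II §1, pp. 118–123).
The tree's `riemannTheta Ω z` (`RiemannTheta.lean`) is the characteristic `[0; 0]`
(`riemannThetaChar_zero_zero`), and its level-three family `e^{2πi ᵗc z} ϑ(3z + Ωc, 3Ω)`
(`RiemannThetaLevelThree.lean`) consists of the functions `ϑ[c/3; 0](3z, 3Ω)` up to the constants
`e^{-πi ᵗcΩc/3}` (`levelThree_eq_cexp_mul_riemannThetaChar`).

Contents (everything proved; the two definitions have bodies; no named fact is introduced):

* `riemannThetaCharTerm`, `riemannThetaChar` — the general term and the function;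
* `riemannThetaCharTerm_eq_cexp_mul`, `riemannThetaChar_eq_cexp_mul_riemannTheta` — **reduction to
  `ϑ`**: `ϑ[a; b](z, Ω) = exp(πi ᵗaΩa + 2πi ᵗa(z + b)) · ϑ(z + Ωa + b, Ω)` for symmetric `Ω`
  (Lange Exercise 3.3.4 (5), PDF p. 179; Mumford II §1);
* `summable_norm_riemannThetaCharTerm`, `hasSum_riemannThetaChar`, `differentiable_riemannThetaChar`
  — absolute convergence and **holomorphy in `z`** under `Im Ω ≥ c > 0` (Lange Prop. 3.3.6,
  PDF p. 173; from the tree's Gaussian majorant for `ϑ` through the reduction);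
* `riemannThetaChar_add_intCast`, `riemannThetaChar_add_mulVec`, `riemannThetaChar_add_mulVec_add_intCast`
  — the **functional equation** (Lange Exercise 3.3.4 (1), PDF pp. 177–178; Mumford p. 123):
  `ϑ[a;b](z + Ωλ¹ + λ²) = exp(2πi(ᵗaλ² - ᵗbλ¹) - πi ᵗλ¹Ωλ¹ - 2πi ᵗλ¹z) ϑ[a;b](z)`, `λ¹, λ² ∈ ℤ^g`;
* `riemannThetaChar_charShift_fst/snd`, `riemannThetaChar_charShift` — **integral shifts of the
  characteristic**: `ϑ[a + n; b + n'] = exp(2πi ᵗa n') ϑ[a; b]` (Mumford p. 123; Lange Exercise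
  3.3.4 (3) prints this without the root of unity `exp(2πi ᵗa n')`, which is needed);
* `riemannThetaChar_neg` — `ϑ[a; b](-z) = ϑ[-a; -b](z)`;
* **type-`D` automorphy** (Lange Exercise 3.3.4 (4)(i), direction `⇐`, PDF p. 178): for a type
  `D = diag(d₁, …, d_g)`, `a ∈ D⁻¹ℤ^g` and `b ∈ ℤ^g`, `ϑ[a; b](·, Ω)` is a theta function for the
  classical factor `e[0;0](Ωλ¹ + Dλ², z) = exp(-πi ᵗλ¹Ωλ¹ - 2πi ᵗλ¹ z)` of the lattice
  `Ωℤ^g ⊕ Dℤ^g` (`riemannThetaChar_add_mulVec_add_type`); and at level `ℓ ≥ 1`, for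
  `a ∈ (ℓD)⁻¹ℤ^g`, the functions `z ↦ ϑ[a; 0](ℓz, ℓΩ)` are entire, `Dℤ^g`-periodic and have the
  COMMON factor `exp(-ℓπi ᵗnΩn - 2ℓπi ᵗn z)` along `Ωℤ^g` (`riemannThetaChar_level_add_type`,
  `riemannThetaChar_level_add_mulVec`, `differentiable_riemannThetaChar_level`) — the
  `ℓ^g d₁⋯d_g` classical theta functions for the `ℓ`-th power of the type-`D` bundle on
  `ℂ^g/(Ωℤ^g ⊕ Dℤ^g)` (for `D = 1`, `ℓ = 3` the tree's level-three family).

Design: characteristics are complex vectors (the classical real/rational ones are a special case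
and every identity is polynomial–exponential in them); `Ω` is assumed symmetric exactly where the
printed identity needs `ᵗxΩy = ᵗyΩx`; convergence hypotheses are the tree's
`Im Ω ≥ c > 0` as a quadratic form (`exists_pos_mul_sum_sq_le_of_posDef_im` supplies `c`).

Not here: linear independence / `dim H⁰ = d₁⋯d_g` (Lange Exercise 3.3.4 (4)(ii), Thm. 3.2.7),
holomorphy in `Ω` and the heat equation (Prop. 3.3.7), the theta transformation formula
(Thm. 3.3.9), product formulas at general type.

## References

* [LangeBirkenhake1992] H. Lange, Ch. Birkenhake, Complex Abelian Varieties (held copy: §3.3.2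
  (3.10), Lemma 3.3.5, Prop. 3.3.6, Exercises 3.3.4 (1), (3), (4), (5); PDF pp. 172–179).
* [MumfordTata1] D. Mumford, Tata Lectures on Theta I (1983), Ch. II §1, pp. 118–124.
-/

noncomputable section

open Complex Real Finset Filter Topology Matrix

namespace Literature.Analysis.SpecialFunctions

variable {g : ℕ}

/-! ### Definition -/

/-- The general term `exp(πi ᵗ(m+a) Ω (m+a) + 2πi ᵗ(m+a)(z+b))`, `m ∈ ℤ^g`, of the theta series
with characteristic `[a; b]`. [cite: LangeBirkenhake1992, §3.3.2 (3.10)] -/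
def riemannThetaCharTerm (a b : Fin g → ℂ) (Ω : Matrix (Fin g) (Fin g) ℂ) (z : Fin g → ℂ)
    (m : Fin g → ℤ) : ℂ :=
  cexp (π * I * (((fun i => (m i : ℂ)) + a) ⬝ᵥ (Ω *ᵥ ((fun i => (m i : ℂ)) + a))) +
    2 * π * I * (((fun i => (m i : ℂ)) + a) ⬝ᵥ (z + b)))

/-- **The Riemann theta function with characteristic `[a; b]`**,
`ϑ[a; b](z, Ω) = Σ_{m ∈ ℤ^g} exp(πi ᵗ(m+a) Ω (m+a) + 2πi ᵗ(m+a)(z+b))` (Lange (3.10); Mumford,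
Tata I, Ch. II §1: "theta functions with rational characteristics"). [cite: LangeBirkenhake1992, §3.3.2 (3.10)]
[cite: MumfordTata1, Ch. II §1] -/
def riemannThetaChar (a b : Fin g → ℂ) (Ω : Matrix (Fin g) (Fin g) ℂ) (z : Fin g → ℂ) : ℂ :=
  ∑' m : Fin g → ℤ, riemannThetaCharTerm a b Ω z m

/-- Unfolding of `riemannThetaChar`: the series (3.10). [cite: LangeBirkenhake1992, §3.3.2 (3.10)] -/
theorem riemannThetaChar_def (a b : Fin g → ℂ) (Ω : Matrix (Fin g) (Fin g) ℂ) (z : Fin g → ℂ) :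
    riemannThetaChar a b Ω z = ∑' m : Fin g → ℤ, riemannThetaCharTerm a b Ω z m := rfl

/-! ### Bookkeeping: integer vectors and exponentials -/

/-- The cast of a sum of integer vectors is the sum of the casts. [folklore] -/
private theorem intCast_vec_add (m n : Fin g → ℤ) :
    (fun i => (((m + n) i : ℤ) : ℂ)) = (fun i => (m i : ℂ)) + fun i => (n i : ℂ) := by
  funext i
  simp

/-- The cast of the negative of an integer vector. [folklore] -/
private theorem intCast_vec_neg (m : Fin g → ℤ) :
    (fun i => (((-m) i : ℤ) : ℂ)) = -fun i => (m i : ℂ) := by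
  funext i
  simp

/-- `exp(2πi ᵗm n) = 1` for integer vectors `m, n`. [folklore] -/
private theorem cexp_two_pi_I_mul_intCast_dotProduct_intCast (m n : Fin g → ℤ) :
    cexp (2 * π * I * ((fun i => (m i : ℂ)) ⬝ᵥ fun i => (n i : ℂ))) = 1 := by
  have h : ((fun i => (m i : ℂ)) ⬝ᵥ fun i => (n i : ℂ)) = ((∑ i, m i * n i : ℤ) : ℂ) := by
    simp only [dotProduct]
    push_cast
    rfl
  rw [h, show 2 * (π : ℂ) * I * ((∑ i, m i * n i : ℤ) : ℂ) =
    ((∑ i, m i * n i : ℤ) : ℂ) * (2 * π * I) by ring]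
  exact Complex.exp_int_mul_two_pi_mul_I _

/-- `exp(-2πi ᵗm n) = 1` for integer vectors `m, n`. [folklore] -/
private theorem cexp_neg_two_pi_I_mul_intCast_dotProduct_intCast (m n : Fin g → ℤ) :
    cexp (-(2 * π * I * ((fun i => (m i : ℂ)) ⬝ᵥ fun i => (n i : ℂ)))) = 1 := by
  rw [Complex.exp_neg, cexp_two_pi_I_mul_intCast_dotProduct_intCast, inv_one]

/-! ### The exponent: algebraic identities -/

/-- Exponent of the general term versus that of `ϑ` at the shifted point (symmetric `Ω`):
`πi ᵗ(M+a)Ω(M+a) + 2πi ᵗ(M+a)(z+b) = [πi ᵗaΩa + 2πi ᵗa(z+b)] + [πi ᵗMΩM + 2πi ᵗM(z + Ωa + b)]`.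
[folklore] -/
private theorem charExponent_eq_add (Ω : Matrix (Fin g) (Fin g) ℂ) (hΩ : ∀ i j, Ω i j = Ω j i)
    (a b z M : Fin g → ℂ) :
    π * I * ((M + a) ⬝ᵥ (Ω *ᵥ (M + a))) + 2 * π * I * ((M + a) ⬝ᵥ (z + b)) =
      (π * I * (a ⬝ᵥ (Ω *ᵥ a)) + 2 * π * I * (a ⬝ᵥ (z + b))) +
        (π * I * (M ⬝ᵥ (Ω *ᵥ M)) + 2 * π * I * (M ⬝ᵥ (z + Ω *ᵥ a + b))) := by
  simp only [add_dotProduct, dotProduct_add, Matrix.mulVec_add]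
  rw [dotProduct_mulVec_comm_of_symm Ω hΩ a M]
  ring

/-- Exponent under `z ↦ z + N`: it changes by `2πi ᵗa N + 2πi ᵗM N`. [folklore] -/
private theorem charExponent_add_vec (Ω : Matrix (Fin g) (Fin g) ℂ) (a b z M N : Fin g → ℂ) :
    π * I * ((M + a) ⬝ᵥ (Ω *ᵥ (M + a))) + 2 * π * I * ((M + a) ⬝ᵥ (z + N + b)) =
      2 * π * I * (a ⬝ᵥ N) +
        (π * I * ((M + a) ⬝ᵥ (Ω *ᵥ (M + a))) + 2 * π * I * ((M + a) ⬝ᵥ (z + b))) +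
        2 * π * I * (M ⬝ᵥ N) := by
  simp only [add_dotProduct, dotProduct_add]
  ring

/-- Exponent under `z ↦ z + ΩN` versus the exponent at `M + N` (symmetric `Ω`): they differ by
`-πi ᵗNΩN - 2πi ᵗN z - 2πi ᵗb N`. [folklore] -/
private theorem charExponent_add_mulVec (Ω : Matrix (Fin g) (Fin g) ℂ) (hΩ : ∀ i j, Ω i j = Ω j i)
    (a b z M N : Fin g → ℂ) :
    π * I * ((M + a) ⬝ᵥ (Ω *ᵥ (M + a))) + 2 * π * I * ((M + a) ⬝ᵥ (z + Ω *ᵥ N + b)) =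
      (-(π * I * (N ⬝ᵥ (Ω *ᵥ N))) - 2 * π * I * (N ⬝ᵥ z) - 2 * π * I * (b ⬝ᵥ N)) +
        (π * I * ((M + N + a) ⬝ᵥ (Ω *ᵥ (M + N + a))) + 2 * π * I * ((M + N + a) ⬝ᵥ (z + b))) := by
  simp only [add_dotProduct, dotProduct_add, Matrix.mulVec_add]
  have s := dotProduct_mulVec_comm_of_symm Ω hΩ
  rw [s N M, s N a, dotProduct_comm b N, dotProduct_comm N z, dotProduct_comm M z,
    dotProduct_comm a z]
  ring

/-! ### Reduction to the Riemann theta function -/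

/-- **Termwise reduction**: for symmetric `Ω`,
`exp(πi ᵗ(m+a)Ω(m+a) + 2πi ᵗ(m+a)(z+b)) = exp(πi ᵗaΩa + 2πi ᵗa(z+b)) · exp(πi ᵗmΩm + 2πi ᵗm(z + Ωa + b))`.
[cite: LangeBirkenhake1992, §3.3.4 Exercise (5)] -/
theorem riemannThetaCharTerm_eq_cexp_mul (Ω : Matrix (Fin g) (Fin g) ℂ) (hΩ : ∀ i j, Ω i j = Ω j i)
    (a b z : Fin g → ℂ) (m : Fin g → ℤ) :
    riemannThetaCharTerm a b Ω z m =
      cexp (π * I * (a ⬝ᵥ (Ω *ᵥ a)) + 2 * π * I * (a ⬝ᵥ (z + b))) *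
        riemannThetaTerm Ω (z + Ω *ᵥ a + b) m := by
  rw [riemannThetaTerm_eq_cexp_dotProduct, riemannThetaCharTerm, ← Complex.exp_add,
    charExponent_eq_add Ω hΩ]

/-- **`ϑ[a; b](z, Ω) = exp(πi ᵗaΩa + 2πi ᵗa(z + b)) · ϑ(z + Ωa + b, Ω)`** for symmetric `Ω`
(Lange Exercise 3.3.4 (5); Mumford, Tata I, Ch. II §1). No convergence hypothesis is needed.
[cite: LangeBirkenhake1992, §3.3.4 Exercise (5)] [cite: MumfordTata1, Ch. II §1] -/
theorem riemannThetaChar_eq_cexp_mul_riemannTheta (Ω : Matrix (Fin g) (Fin g) ℂ)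
    (hΩ : ∀ i j, Ω i j = Ω j i) (a b z : Fin g → ℂ) :
    riemannThetaChar a b Ω z =
      cexp (π * I * (a ⬝ᵥ (Ω *ᵥ a)) + 2 * π * I * (a ⬝ᵥ (z + b))) *
        riemannTheta Ω (z + Ω *ᵥ a + b) := by
  unfold riemannThetaChar riemannTheta
  simp_rw [riemannThetaCharTerm_eq_cexp_mul Ω hΩ a b z]
  exact tsum_mul_left

/-- The term with characteristic `[0; 0]` is the Riemann theta term of (3.10) with `c¹ = c² = 0`.
[cite: LangeBirkenhake1992, §3.3.2 (3.10)] -/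
theorem riemannThetaCharTerm_zero_zero (Ω : Matrix (Fin g) (Fin g) ℂ) (z : Fin g → ℂ)
    (m : Fin g → ℤ) : riemannThetaCharTerm 0 0 Ω z m = riemannThetaTerm Ω z m := by
  rw [riemannThetaTerm_eq_cexp_dotProduct, riemannThetaCharTerm]
  simp only [add_zero]

/-- **`ϑ[0; 0] = ϑ`**: the tree's `riemannTheta` is the theta function with characteristic
`[0; 0]` (Lange: "the classical Riemann theta function with characteristic `[0; 0]`").
[cite: LangeBirkenhake1992, §3.3.2 (3.10)] -/
theorem riemannThetaChar_zero_zero (Ω : Matrix (Fin g) (Fin g) ℂ) (z : Fin g → ℂ) :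
    riemannThetaChar 0 0 Ω z = riemannTheta Ω z := by
  unfold riemannThetaChar riemannTheta
  exact tsum_congr fun m => riemannThetaCharTerm_zero_zero Ω z m

/-- `ϑ[a; b](z) = ϑ[a; 0](z + b)`: the second characteristic is a translation. [cite: MumfordTata1, Ch. II §1] -/
theorem riemannThetaChar_eq_riemannThetaChar_zero_add (a b : Fin g → ℂ)
    (Ω : Matrix (Fin g) (Fin g) ℂ) (z : Fin g → ℂ) :
    riemannThetaChar a b Ω z = riemannThetaChar a 0 Ω (z + b) := by
  unfold riemannThetaChar riemannThetaCharTerm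
  simp only [add_zero]

/-! ### Convergence and holomorphy in `z` -/

/-- **Absolute convergence** of the series of `ϑ[a; b](z, Ω)` for symmetric `Ω` with
`Im Ω ≥ c > 0` (Lange Prop. 3.3.6: "converges absolutely and uniformly on every compact set").
[cite: LangeBirkenhake1992, §3.3.2 Prop. 3.3.6] -/
theorem summable_norm_riemannThetaCharTerm (Ω : Matrix (Fin g) (Fin g) ℂ)
    (hΩ : ∀ i j, Ω i j = Ω j i) {c : ℝ} (hc : 0 < c)
    (hY : ∀ x : Fin g → ℝ, c * ∑ i, x i ^ 2 ≤ ∑ i, ∑ j, x i * (Ω i j).im * x j)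
    (a b z : Fin g → ℂ) :
    Summable fun m : Fin g → ℤ => ‖riemannThetaCharTerm a b Ω z m‖ := by
  simp_rw [riemannThetaCharTerm_eq_cexp_mul Ω hΩ a b z, norm_mul]
  exact (summable_norm_riemannThetaTerm Ω hc hY _).mul_left _

/-- The series of `ϑ[a; b](z, Ω)` converges. [cite: LangeBirkenhake1992, §3.3.2 Prop. 3.3.6] -/
theorem summable_riemannThetaCharTerm (Ω : Matrix (Fin g) (Fin g) ℂ)
    (hΩ : ∀ i j, Ω i j = Ω j i) {c : ℝ} (hc : 0 < c)
    (hY : ∀ x : Fin g → ℝ, c * ∑ i, x i ^ 2 ≤ ∑ i, ∑ j, x i * (Ω i j).im * x j)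
    (a b z : Fin g → ℂ) :
    Summable (riemannThetaCharTerm a b Ω z) :=
  (summable_norm_riemannThetaCharTerm Ω hΩ hc hY a b z).of_norm

/-- `ϑ[a; b](z, Ω)` is the sum of its series. [cite: LangeBirkenhake1992, §3.3.2 Prop. 3.3.6] -/
theorem hasSum_riemannThetaChar (Ω : Matrix (Fin g) (Fin g) ℂ)
    (hΩ : ∀ i j, Ω i j = Ω j i) {c : ℝ} (hc : 0 < c)
    (hY : ∀ x : Fin g → ℝ, c * ∑ i, x i ^ 2 ≤ ∑ i, ∑ j, x i * (Ω i j).im * x j)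
    (a b z : Fin g → ℂ) :
    HasSum (riemannThetaCharTerm a b Ω z) (riemannThetaChar a b Ω z) :=
  (summable_riemannThetaCharTerm Ω hΩ hc hY a b z).hasSum

/-- **`ϑ[a; b](·, Ω)` is holomorphic on `ℂ^g`** for symmetric `Ω` with `Im Ω ≥ c > 0`
(Lange Prop. 3.3.6, the `z`-direction). [cite: LangeBirkenhake1992, §3.3.2 Prop. 3.3.6] -/
theorem differentiable_riemannThetaChar (Ω : Matrix (Fin g) (Fin g) ℂ)
    (hΩ : ∀ i j, Ω i j = Ω j i) {c : ℝ} (hc : 0 < c)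
    (hY : ∀ x : Fin g → ℝ, c * ∑ i, x i ^ 2 ≤ ∑ i, ∑ j, x i * (Ω i j).im * x j)
    (a b : Fin g → ℂ) :
    Differentiable ℂ (riemannThetaChar a b Ω) := by
  have h : riemannThetaChar a b Ω = fun z =>
      cexp (π * I * (a ⬝ᵥ (Ω *ᵥ a)) + 2 * π * I * (a ⬝ᵥ (z + b))) *
        riemannTheta Ω (z + Ω *ᵥ a + b) :=
    funext fun z => riemannThetaChar_eq_cexp_mul_riemannTheta Ω hΩ a b z
  rw [h]
  have hlin : Differentiable ℂ fun z : Fin g → ℂ => a ⬝ᵥ (z + b) := by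
    simp only [dotProduct, Pi.add_apply]
    fun_prop
  refine (((hlin.const_mul (2 * π * I)).const_add (π * I * (a ⬝ᵥ (Ω *ᵥ a)))).cexp).mul ?_
  exact (differentiable_riemannTheta Ω hc hY).comp (by fun_prop)

/-! ### The functional equation -/

/-- Termwise: `z ↦ z + n` (`n ∈ ℤ^g`) multiplies the general term by `exp(2πi ᵗa n)` (the
computation behind Mumford's `ϑ[a;b](z + n) = e^{2πi ᵗa n} ϑ[a;b](z)`). [cite: MumfordTata1, Ch. II §1] -/
theorem riemannThetaCharTerm_add_intCast (a b : Fin g → ℂ) (Ω : Matrix (Fin g) (Fin g) ℂ)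
    (z : Fin g → ℂ) (n m : Fin g → ℤ) :
    riemannThetaCharTerm a b Ω (z + fun i => (n i : ℂ)) m =
      cexp (2 * π * I * (a ⬝ᵥ fun i => (n i : ℂ))) * riemannThetaCharTerm a b Ω z m := by
  simp only [riemannThetaCharTerm]
  rw [charExponent_add_vec, Complex.exp_add, Complex.exp_add,
    cexp_two_pi_I_mul_intCast_dotProduct_intCast, mul_one]

/-- **Periodicity up to a character**: `ϑ[a; b](z + n, Ω) = exp(2πi ᵗa n) ϑ[a; b](z, Ω)` for
`n ∈ ℤ^g` (Mumford p. 123; the `λ²`-part of Lange Exercise 3.3.4 (1)).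
[cite: MumfordTata1, Ch. II §1] [cite: LangeBirkenhake1992, §3.3.4 Exercise (1)] -/
theorem riemannThetaChar_add_intCast (a b : Fin g → ℂ) (Ω : Matrix (Fin g) (Fin g) ℂ)
    (z : Fin g → ℂ) (n : Fin g → ℤ) :
    riemannThetaChar a b Ω (z + fun i => (n i : ℂ)) =
      cexp (2 * π * I * (a ⬝ᵥ fun i => (n i : ℂ))) * riemannThetaChar a b Ω z := by
  unfold riemannThetaChar
  simp_rw [riemannThetaCharTerm_add_intCast a b Ω z n]
  exact tsum_mul_left

/-- Termwise: `z ↦ z + Ωn` (`n ∈ ℤ^g`, symmetric `Ω`) gives the factor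
`exp(-πi ᵗnΩn - 2πi ᵗn z - 2πi ᵗb n)` times the term at `m + n` (the computation behind Mumford's
quasi-periodicity law). [cite: MumfordTata1, Ch. II §1] -/
theorem riemannThetaCharTerm_add_mulVec (a b : Fin g → ℂ) (Ω : Matrix (Fin g) (Fin g) ℂ)
    (hΩ : ∀ i j, Ω i j = Ω j i) (z : Fin g → ℂ) (n m : Fin g → ℤ) :
    riemannThetaCharTerm a b Ω (z + Ω *ᵥ fun i => (n i : ℂ)) m =
      cexp (-(π * I * ((fun i => (n i : ℂ)) ⬝ᵥ (Ω *ᵥ fun i => (n i : ℂ)))) -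
          2 * π * I * ((fun i => (n i : ℂ)) ⬝ᵥ z) - 2 * π * I * (b ⬝ᵥ fun i => (n i : ℂ))) *
        riemannThetaCharTerm a b Ω z (m + n) := by
  simp only [riemannThetaCharTerm]
  rw [charExponent_add_mulVec Ω hΩ, Complex.exp_add, intCast_vec_add]

/-- **Quasi-periodicity**: for symmetric `Ω` and `n ∈ ℤ^g`,
`ϑ[a; b](z + Ωn, Ω) = exp(-2πi ᵗb n) · exp(-πi ᵗnΩn - 2πi ᵗn z) · ϑ[a; b](z, Ω)`
(Mumford p. 123; the `λ¹`-part of Lange Exercise 3.3.4 (1)).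
[cite: MumfordTata1, Ch. II §1] [cite: LangeBirkenhake1992, §3.3.4 Exercise (1)] -/
theorem riemannThetaChar_add_mulVec (a b : Fin g → ℂ) (Ω : Matrix (Fin g) (Fin g) ℂ)
    (hΩ : ∀ i j, Ω i j = Ω j i) (z : Fin g → ℂ) (n : Fin g → ℤ) :
    riemannThetaChar a b Ω (z + Ω *ᵥ fun i => (n i : ℂ)) =
      cexp (-(π * I * ((fun i => (n i : ℂ)) ⬝ᵥ (Ω *ᵥ fun i => (n i : ℂ)))) -
          2 * π * I * ((fun i => (n i : ℂ)) ⬝ᵥ z) - 2 * π * I * (b ⬝ᵥ fun i => (n i : ℂ))) *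
        riemannThetaChar a b Ω z := by
  unfold riemannThetaChar
  rw [← tsum_mul_left]
  conv_rhs => rw [← (Equiv.addRight n).tsum_eq]
  exact tsum_congr fun m => riemannThetaCharTerm_add_mulVec a b Ω hΩ z n m

/-- **The functional equation** (Lange Exercise 3.3.4 (1); Mumford, Tata I, p. 123): for symmetric
`Ω` and `λ¹, λ² ∈ ℤ^g`,
`ϑ[a; b](z + Ωλ¹ + λ², Ω) = exp(2πi(ᵗaλ² - ᵗbλ¹) - πi ᵗλ¹Ωλ¹ - 2πi ᵗλ¹ z) · ϑ[a; b](z, Ω)` —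
`ϑ[a; b](·, Ω)` is a theta function for the lattice `Ωℤ^g ⊕ ℤ^g`.
[cite: LangeBirkenhake1992, §3.3.4 Exercise (1)] [cite: MumfordTata1, Ch. II §1] -/
theorem riemannThetaChar_add_mulVec_add_intCast (a b : Fin g → ℂ) (Ω : Matrix (Fin g) (Fin g) ℂ)
    (hΩ : ∀ i j, Ω i j = Ω j i) (z : Fin g → ℂ) (l₁ l₂ : Fin g → ℤ) :
    riemannThetaChar a b Ω (z + (Ω *ᵥ fun i => (l₁ i : ℂ)) + fun i => (l₂ i : ℂ)) =
      cexp (2 * π * I * ((a ⬝ᵥ fun i => (l₂ i : ℂ)) - b ⬝ᵥ fun i => (l₁ i : ℂ)) -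
          π * I * ((fun i => (l₁ i : ℂ)) ⬝ᵥ (Ω *ᵥ fun i => (l₁ i : ℂ))) -
          2 * π * I * ((fun i => (l₁ i : ℂ)) ⬝ᵥ z)) *
        riemannThetaChar a b Ω z := by
  rw [riemannThetaChar_add_intCast, riemannThetaChar_add_mulVec a b Ω hΩ, ← mul_assoc,
    ← Complex.exp_add]
  congr 2
  ring

/-! ### Integral shifts of the characteristic -/

/-- Termwise: `ϑ[a + n; b]` has the terms of `ϑ[a; b]` reindexed by `m ↦ m + n` (the computation
behind Mumford's `ϑ[a + n; b + m] = e^{2πi ᵗa m} ϑ[a; b]`). [cite: MumfordTata1, Ch. II §1] -/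
theorem riemannThetaCharTerm_charShift_fst (a b : Fin g → ℂ) (Ω : Matrix (Fin g) (Fin g) ℂ)
    (z : Fin g → ℂ) (n m : Fin g → ℤ) :
    riemannThetaCharTerm (a + fun i => (n i : ℂ)) b Ω z m = riemannThetaCharTerm a b Ω z (m + n) := by
  simp only [riemannThetaCharTerm, intCast_vec_add]
  rw [show (fun i => (m i : ℂ)) + (a + fun i => (n i : ℂ)) =
    (fun i => (m i : ℂ)) + (fun i => (n i : ℂ)) + a from by abel]

/-- **`ϑ[a + n; b] = ϑ[a; b]`** for `n ∈ ℤ^g`. [cite: MumfordTata1, Ch. II §1]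
[cite: LangeBirkenhake1992, §3.3.4 Exercise (3)] -/
theorem riemannThetaChar_charShift_fst (a b : Fin g → ℂ) (Ω : Matrix (Fin g) (Fin g) ℂ)
    (z : Fin g → ℂ) (n : Fin g → ℤ) :
    riemannThetaChar (a + fun i => (n i : ℂ)) b Ω z = riemannThetaChar a b Ω z := by
  unfold riemannThetaChar
  rw [← (Equiv.addRight n).tsum_eq (fun m => riemannThetaCharTerm a b Ω z m)]
  exact tsum_congr fun m => riemannThetaCharTerm_charShift_fst a b Ω z n m

/-- **`ϑ[a; b + n] = exp(2πi ᵗa n) ϑ[a; b]`** for `n ∈ ℤ^g` (Mumford p. 123). Lange's Exercise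
3.3.4 (3) states `ϑ[a + n; b + n'] = ϑ[a; b]`; the root of unity `exp(2πi ᵗa n')` is needed.
[cite: MumfordTata1, Ch. II §1] [cite: LangeBirkenhake1992, §3.3.4 Exercise (3)] -/
theorem riemannThetaChar_charShift_snd (a b : Fin g → ℂ) (Ω : Matrix (Fin g) (Fin g) ℂ)
    (z : Fin g → ℂ) (n : Fin g → ℤ) :
    riemannThetaChar a (b + fun i => (n i : ℂ)) Ω z =
      cexp (2 * π * I * (a ⬝ᵥ fun i => (n i : ℂ))) * riemannThetaChar a b Ω z := by
  rw [riemannThetaChar_eq_riemannThetaChar_zero_add, ← add_assoc, riemannThetaChar_add_intCast,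
    ← riemannThetaChar_eq_riemannThetaChar_zero_add]

/-- **Integral shifts of the characteristic**: `ϑ[a + n; b + n'] = exp(2πi ᵗa n') ϑ[a; b]` for
`n, n' ∈ ℤ^g` — the characteristic matters only modulo `ℤ^g ⊕ ℤ^g`, up to a root of unity.
[cite: MumfordTata1, Ch. II §1] [cite: LangeBirkenhake1992, §3.3.4 Exercise (3)] -/
theorem riemannThetaChar_charShift (a b : Fin g → ℂ) (Ω : Matrix (Fin g) (Fin g) ℂ)
    (z : Fin g → ℂ) (n n' : Fin g → ℤ) :
    riemannThetaChar (a + fun i => (n i : ℂ)) (b + fun i => (n' i : ℂ)) Ω z =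
      cexp (2 * π * I * (a ⬝ᵥ fun i => (n' i : ℂ))) * riemannThetaChar a b Ω z := by
  rw [riemannThetaChar_charShift_fst, riemannThetaChar_charShift_snd]

/-! ### Parity -/

/-- Termwise: the term of `ϑ[a; b]` at `-z` and `m` is the term of `ϑ[-a; -b]` at `z` and `-m`
(the computation behind Mumford's `ϑ[a; b](-z) = ϑ[-a; -b](z)`). [cite: MumfordTata1, Ch. II §1] -/
theorem riemannThetaCharTerm_neg (a b : Fin g → ℂ) (Ω : Matrix (Fin g) (Fin g) ℂ) (z : Fin g → ℂ)
    (m : Fin g → ℤ) :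
    riemannThetaCharTerm a b Ω (-z) m = riemannThetaCharTerm (-a) (-b) Ω z (-m) := by
  simp only [riemannThetaCharTerm, intCast_vec_neg]
  rw [show (-fun i => (m i : ℂ)) + -a = -((fun i => (m i : ℂ)) + a) from by abel,
    show z + -b = -(-z + b) from by abel]
  simp only [neg_dotProduct, dotProduct_neg, Matrix.mulVec_neg, neg_neg]

/-- **`ϑ[a; b](-z, Ω) = ϑ[-a; -b](z, Ω)`** (Mumford p. 123; in particular `ϑ[0;0]` is even).
[cite: MumfordTata1, Ch. II §1] -/
theorem riemannThetaChar_neg (a b : Fin g → ℂ) (Ω : Matrix (Fin g) (Fin g) ℂ) (z : Fin g → ℂ) :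
    riemannThetaChar a b Ω (-z) = riemannThetaChar (-a) (-b) Ω z := by
  unfold riemannThetaChar
  rw [← (Equiv.neg (Fin g → ℤ)).tsum_eq (fun m => riemannThetaCharTerm (-a) (-b) Ω z m)]
  exact tsum_congr fun m => riemannThetaCharTerm_neg a b Ω z m

/-! ### Type-`D` automorphy: theta functions for the lattice `Ωℤ^g ⊕ Dℤ^g` -/

/-- A `Dℤ^g`-vector is an integer vector: `(dᵢ λᵢ)ᵢ`. [folklore] -/
private theorem natCast_mul_intCast_vec (d : Fin g → ℕ) (l : Fin g → ℤ) :
    (fun i => (d i : ℂ) * (l i : ℂ)) = fun i => (((fun j => (d j : ℤ) * l j) i : ℤ) : ℂ) := by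
  funext i
  push_cast
  ring

/-- If `D a ∈ ℤ^g` (`dᵢ aᵢ = kᵢ`) then `ᵗa (Dλ) = ᵗk λ` is an integer. [folklore] -/
private theorem dotProduct_type_eq (a : Fin g → ℂ) (d : Fin g → ℕ) (k : Fin g → ℤ)
    (ha : ∀ i, (d i : ℂ) * a i = (k i : ℂ)) (l : Fin g → ℤ) :
    (a ⬝ᵥ fun i => (((fun j => (d j : ℤ) * l j) i : ℤ) : ℂ)) =
      (fun i => (k i : ℂ)) ⬝ᵥ fun i => (l i : ℂ) := by
  simp only [dotProduct]
  refine Finset.sum_congr rfl fun i _ => ?_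
  rw [← ha i]
  push_cast
  ring

/-- **Type-`D` automorphy** (Lange Exercise 3.3.4 (4)(i), direction `⇐`): for symmetric `Ω`, a
type `D = diag(d₁,…,d_g)`, `a ∈ D⁻¹ℤ^g` (`dᵢaᵢ ∈ ℤ`) and `b ∈ ℤ^g`, the function `ϑ[a; b](·, Ω)`
satisfies, for all `λ¹, λ² ∈ ℤ^g`,
`ϑ[a; b](z + Ωλ¹ + Dλ², Ω) = exp(-πi ᵗλ¹Ωλ¹ - 2πi ᵗλ¹ z) · ϑ[a; b](z, Ω)` — it is a theta
function for the classical factor `e[0; 0]` of the lattice `Ωℤ^g ⊕ Dℤ^g`, i.e. a classical theta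
function for the type-`D` line bundle of characteristic `0` on `ℂ^g/(Ωℤ^g ⊕ Dℤ^g)`.
[cite: LangeBirkenhake1992, §3.3.4 Exercise (4)] -/
theorem riemannThetaChar_add_mulVec_add_type (a b : Fin g → ℂ) (Ω : Matrix (Fin g) (Fin g) ℂ)
    (hΩ : ∀ i j, Ω i j = Ω j i) (d : Fin g → ℕ) (k b' : Fin g → ℤ)
    (ha : ∀ i, (d i : ℂ) * a i = (k i : ℂ)) (hb : b = fun i => (b' i : ℂ)) (z : Fin g → ℂ)
    (l₁ l₂ : Fin g → ℤ) :
    riemannThetaChar a b Ω (z + (Ω *ᵥ fun i => (l₁ i : ℂ)) + fun i => (d i : ℂ) * (l₂ i : ℂ)) =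
      cexp (-(π * I * ((fun i => (l₁ i : ℂ)) ⬝ᵥ (Ω *ᵥ fun i => (l₁ i : ℂ)))) -
          2 * π * I * ((fun i => (l₁ i : ℂ)) ⬝ᵥ z)) *
        riemannThetaChar a b Ω z := by
  rw [natCast_mul_intCast_vec, riemannThetaChar_add_intCast, dotProduct_type_eq a d k ha,
    cexp_two_pi_I_mul_intCast_dotProduct_intCast, one_mul, riemannThetaChar_add_mulVec a b Ω hΩ,
    hb, sub_eq_add_neg, Complex.exp_add, cexp_neg_two_pi_I_mul_intCast_dotProduct_intCast, mul_one]

/-! ### The level-`ℓ` family of a type `D`: `z ↦ ϑ[a; 0](ℓz, ℓΩ)`, `a ∈ (ℓD)⁻¹ℤ^g` -/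

/-- `Im(ℓΩ) ≥ ℓc` when `Im Ω ≥ c`, for a natural number `ℓ`. [folklore] -/
private theorem natCast_smul_im_bound (Ω : Matrix (Fin g) (Fin g) ℂ) {c : ℝ}
    (hY : ∀ x : Fin g → ℝ, c * ∑ i, x i ^ 2 ≤ ∑ i, ∑ j, x i * (Ω i j).im * x j) (ℓ : ℕ)
    (x : Fin g → ℝ) :
    ℓ * c * ∑ i, x i ^ 2 ≤ ∑ i, ∑ j, x i * (((ℓ : ℂ) • Ω) i j).im * x j := by
  have h := hY x
  have e : ∑ i, ∑ j, x i * (((ℓ : ℂ) • Ω) i j).im * x j = ℓ * ∑ i, ∑ j, x i * (Ω i j).im * x j := by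
    rw [Finset.mul_sum]
    refine Finset.sum_congr rfl fun i _ => ?_
    rw [Finset.mul_sum]
    refine Finset.sum_congr rfl fun j _ => ?_
    simp only [Matrix.smul_apply, smul_eq_mul, Complex.mul_im, Complex.natCast_re,
      Complex.natCast_im, zero_mul, add_zero]
    ring
  rw [e, mul_assoc]
  exact mul_le_mul_of_nonneg_left h (Nat.cast_nonneg ℓ)

/-- `ℓΩ` is symmetric when `Ω` is. [folklore] -/
private theorem natCast_smul_symm (Ω : Matrix (Fin g) (Fin g) ℂ) (hΩ : ∀ i j, Ω i j = Ω j i) (ℓ : ℕ) :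
    ∀ i j, ((ℓ : ℂ) • Ω) i j = ((ℓ : ℂ) • Ω) j i := fun i j => by
  simp only [Matrix.smul_apply, hΩ i j]

/-- **The level-`ℓ` theta functions of type `D` are entire**: for symmetric `Ω` with
`Im Ω ≥ c > 0` and `ℓ ≥ 1`, `z ↦ ϑ[a; b](ℓz, ℓΩ)` is holomorphic on `ℂ^g`.
[cite: LangeBirkenhake1992, §3.3.2 Prop. 3.3.6] -/
theorem differentiable_riemannThetaChar_level (Ω : Matrix (Fin g) (Fin g) ℂ)
    (hΩ : ∀ i j, Ω i j = Ω j i) {c : ℝ} (hc : 0 < c)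
    (hY : ∀ x : Fin g → ℝ, c * ∑ i, x i ^ 2 ≤ ∑ i, ∑ j, x i * (Ω i j).im * x j)
    {ℓ : ℕ} (hℓ : 1 ≤ ℓ) (a b : Fin g → ℂ) :
    Differentiable ℂ fun z : Fin g → ℂ => riemannThetaChar a b ((ℓ : ℂ) • Ω) ((ℓ : ℂ) • z) := by
  have hℓc : 0 < (ℓ : ℝ) * c := mul_pos (by exact_mod_cast hℓ) hc
  exact (differentiable_riemannThetaChar ((ℓ : ℂ) • Ω) (natCast_smul_symm Ω hΩ ℓ) hℓc
    (natCast_smul_im_bound Ω hY ℓ) a b).comp (differentiable_id.const_smul (ℓ : ℂ))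

/-- **`Dℤ^g`-periodicity of the level-`ℓ` family**: if `a ∈ (ℓD)⁻¹ℤ^g` (`ℓ dᵢ aᵢ = kᵢ ∈ ℤ`) then
`ϑ[a; 0](ℓ(z + Dn), ℓΩ) = ϑ[a; 0](ℓz, ℓΩ)` for `n ∈ ℤ^g` (Lange Exercise 3.3.4 (4)(i) for the
`ℓ`-th power of the type-`D` bundle). [cite: LangeBirkenhake1992, §3.3.4 Exercise (4)] -/
theorem riemannThetaChar_level_add_type (a : Fin g → ℂ) (Ω : Matrix (Fin g) (Fin g) ℂ) (ℓ : ℕ)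
    (d : Fin g → ℕ) (k : Fin g → ℤ) (ha : ∀ i, (ℓ : ℂ) * (d i : ℂ) * a i = (k i : ℂ))
    (z : Fin g → ℂ) (n : Fin g → ℤ) :
    riemannThetaChar a 0 ((ℓ : ℂ) • Ω) ((ℓ : ℂ) • (z + fun i => (d i : ℂ) * (n i : ℂ))) =
      riemannThetaChar a 0 ((ℓ : ℂ) • Ω) ((ℓ : ℂ) • z) := by
  have ha' : ∀ i, ((ℓ * d i : ℕ) : ℂ) * a i = (k i : ℂ) := fun i => by
    rw [← ha i]
    push_cast
    ring
  have e : (ℓ : ℂ) • (z + fun i => (d i : ℂ) * (n i : ℂ)) =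
      (ℓ : ℂ) • z + fun i => (((fun j => ((ℓ * d j : ℕ) : ℤ) * n j) i : ℤ) : ℂ) := by
    rw [smul_add]
    congr 1
    funext i
    simp only [Pi.smul_apply, smul_eq_mul]
    push_cast
    ring
  rw [e, riemannThetaChar_add_intCast, dotProduct_type_eq a (fun i => ℓ * d i) k ha',
    cexp_two_pi_I_mul_intCast_dotProduct_intCast, one_mul]

/-- **Common quasi-periodicity of the level-`ℓ` family**: for symmetric `Ω`, `n ∈ ℤ^g` and ANY
characteristic `a`,
`ϑ[a; 0](ℓ(z + Ωn), ℓΩ) = exp(ℓ(-πi ᵗnΩn - 2πi ᵗn z)) · ϑ[a; 0](ℓz, ℓΩ)` — the factor of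
automorphy of the `ℓ`-th power of the type-`D` bundle, the same for every member of the family
(for `ℓ = 3`, `D = 1`: the factor `exp(-3πi ᵗnΩn - 6πi ᵗn z)` of the tree's level-three family).
[cite: LangeBirkenhake1992, §3.3.4 Exercise (4)] [cite: MumfordTata1, Ch. II §1] -/
theorem riemannThetaChar_level_add_mulVec (a : Fin g → ℂ) (Ω : Matrix (Fin g) (Fin g) ℂ)
    (hΩ : ∀ i j, Ω i j = Ω j i) (ℓ : ℕ) (z : Fin g → ℂ) (n : Fin g → ℤ) :
    riemannThetaChar a 0 ((ℓ : ℂ) • Ω) ((ℓ : ℂ) • (z + Ω *ᵥ fun i => (n i : ℂ))) =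
      cexp ((ℓ : ℂ) * (-(π * I * ((fun i => (n i : ℂ)) ⬝ᵥ (Ω *ᵥ fun i => (n i : ℂ)))) -
          2 * π * I * ((fun i => (n i : ℂ)) ⬝ᵥ z))) *
        riemannThetaChar a 0 ((ℓ : ℂ) • Ω) ((ℓ : ℂ) • z) := by
  have e : (ℓ : ℂ) • (z + Ω *ᵥ fun i => (n i : ℂ)) =
      (ℓ : ℂ) • z + ((ℓ : ℂ) • Ω) *ᵥ fun i => (n i : ℂ) := by
    rw [smul_add, Matrix.smul_mulVec]
  rw [e, riemannThetaChar_add_mulVec a 0 _ (natCast_smul_symm Ω hΩ ℓ)]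
  congr 2
  simp only [Matrix.smul_mulVec, dotProduct_smul, zero_dotProduct, smul_eq_mul]
  ring

/-- The `Dℤ^g`-periodicity for the explicit characteristics `a = (ℓD)⁻¹k`, `k ∈ ℤ^g`
(`ℓ, dᵢ ≠ 0`): the `ℓ^g·d₁⋯d_g` classical theta functions `ϑ[(ℓD)⁻¹k; 0](ℓz, ℓΩ)`,
`k ∈ ∏ᵢ ℤ/ℓdᵢℤ`, of the `ℓ`-th power of the type-`D` bundle (Lange Exercise 3.3.4 (4)).
[cite: LangeBirkenhake1992, §3.3.4 Exercise (4)] -/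
theorem riemannThetaChar_level_add_type_div (Ω : Matrix (Fin g) (Fin g) ℂ) {ℓ : ℕ} (hℓ : ℓ ≠ 0)
    {d : Fin g → ℕ} (hd : ∀ i, d i ≠ 0) (k : Fin g → ℤ) (z : Fin g → ℂ) (n : Fin g → ℤ) :
    riemannThetaChar (fun i => (k i : ℂ) / ((ℓ : ℂ) * (d i : ℂ))) 0 ((ℓ : ℂ) • Ω)
        ((ℓ : ℂ) • (z + fun i => (d i : ℂ) * (n i : ℂ))) =
      riemannThetaChar (fun i => (k i : ℂ) / ((ℓ : ℂ) * (d i : ℂ))) 0 ((ℓ : ℂ) • Ω)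
        ((ℓ : ℂ) • z) := by
  refine riemannThetaChar_level_add_type _ Ω ℓ d k (fun i => ?_) z n
  have hℓ' : (ℓ : ℂ) ≠ 0 := Nat.cast_ne_zero.mpr hℓ
  have hd' : (d i : ℂ) ≠ 0 := Nat.cast_ne_zero.mpr (hd i)
  field_simp

/-! ### Level-`ℓ` shifts of `ϑ` as theta functions with characteristics -/

/-- **`e^{2πi ᵗv z} ϑ(ℓz + Ωv, ℓΩ) = e^{-πi ᵗvΩv/ℓ} · ϑ[v/ℓ; 0](ℓz, ℓΩ)`** for symmetric `Ω`,
`ℓ ≠ 0` and any `v ∈ ℂ^g`: the level-`ℓ` translates of `ϑ` used for embeddings (for a type `D`: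
`v = D⁻¹k`, `k ∈ ℤ^g`) are the classical theta functions with characteristic `[v/ℓ; 0]` up to
non-zero constants (Mumford, Tata I, Ch. II §1, pp. 122–124, the case `ℓ = 3`, `D = 1`).
[cite: MumfordTata1, Ch. II §1 (pp. 122–124)] [cite: LangeBirkenhake1992, §3.3.4 Exercise (5)] -/
theorem cexp_mul_riemannTheta_level_eq_cexp_mul_riemannThetaChar (Ω : Matrix (Fin g) (Fin g) ℂ)
    (hΩ : ∀ i j, Ω i j = Ω j i) {ℓ : ℕ} (hℓ : ℓ ≠ 0) (v z : Fin g → ℂ) :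
    cexp (2 * π * I * (v ⬝ᵥ z)) *
        riemannTheta ((ℓ : ℂ) • Ω) (fun i => (ℓ : ℂ) * z i + (Ω *ᵥ v) i) =
      cexp (-(π * I * (v ⬝ᵥ (Ω *ᵥ v)) / (ℓ : ℂ))) *
        riemannThetaChar ((ℓ : ℂ)⁻¹ • v) 0 ((ℓ : ℂ) • Ω) ((ℓ : ℂ) • z) := by
  have hℓ' : (ℓ : ℂ) ≠ 0 := Nat.cast_ne_zero.mpr hℓ
  rw [riemannThetaChar_eq_cexp_mul_riemannTheta ((ℓ : ℂ) • Ω) (natCast_smul_symm Ω hΩ ℓ)]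
  have hΩv : ((ℓ : ℂ) • Ω) *ᵥ ((ℓ : ℂ)⁻¹ • v) = Ω *ᵥ v := by
    rw [Matrix.mulVec_smul, Matrix.smul_mulVec, smul_smul, inv_mul_cancel₀ hℓ', one_smul]
  have harg : (ℓ : ℂ) • z + ((ℓ : ℂ) • Ω) *ᵥ ((ℓ : ℂ)⁻¹ • v) + 0 =
      fun i => (ℓ : ℂ) * z i + (Ω *ᵥ v) i := by
    rw [hΩv, add_zero]
    funext i
    simp
  rw [harg, ← mul_assoc, ← Complex.exp_add]
  congr 2
  simp only [hΩv, add_zero, smul_dotProduct, dotProduct_smul, smul_eq_mul]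
  field_simp
  ring

/-! ### The tree's level-three family as theta functions with characteristics -/

/-- **`e^{2πi ᵗc z} ϑ(3z + Ωc, 3Ω) = e^{-πi ᵗcΩc/3} · ϑ[c/3; 0](3z, 3Ω)`** for symmetric `Ω` and
`c ∈ {0,1,2}^g`: the level-three family of `RiemannThetaLevelThree.lean` is the classical basis
`ϑ[c/3; 0](3z, 3Ω)` up to constants (Mumford, Tata I, Ch. II §1, pp. 122–124).
[cite: MumfordTata1, Ch. II §1 (pp. 122–124)] -/
theorem levelThree_eq_cexp_mul_riemannThetaChar (Ω : Matrix (Fin g) (Fin g) ℂ)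
    (hΩ : ∀ i j, Ω i j = Ω j i) (c₃ : Fin g → Fin 3) (z : Fin g → ℂ) :
    cexp (2 * π * I * ((fun i => ((c₃ i : ℕ) : ℂ)) ⬝ᵥ z)) *
        riemannTheta ((3 : ℂ) • Ω) (fun i => 3 * z i + (Ω *ᵥ fun j => ((c₃ j : ℕ) : ℂ)) i) =
      cexp (-(π * I * ((fun i => ((c₃ i : ℕ) : ℂ)) ⬝ᵥ (Ω *ᵥ fun i => ((c₃ i : ℕ) : ℂ))) / 3)) *
        riemannThetaChar ((3 : ℂ)⁻¹ • fun i => ((c₃ i : ℕ) : ℂ)) 0 ((3 : ℂ) • Ω) ((3 : ℂ) • z) := by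
  have h3 : ∀ i j, ((3 : ℂ) • Ω) i j = ((3 : ℂ) • Ω) j i := fun i j => by
    simp only [Matrix.smul_apply, hΩ i j]
  rw [riemannThetaChar_eq_cexp_mul_riemannTheta ((3 : ℂ) • Ω) h3]
  set C : Fin g → ℂ := fun i => ((c₃ i : ℕ) : ℂ) with hC
  have hΩC : ((3 : ℂ) • Ω) *ᵥ ((3 : ℂ)⁻¹ • C) = Ω *ᵥ C := by
    rw [Matrix.mulVec_smul, Matrix.smul_mulVec, smul_smul]
    norm_num
  have harg : (3 : ℂ) • z + ((3 : ℂ) • Ω) *ᵥ ((3 : ℂ)⁻¹ • C) + 0 =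
      fun i => 3 * z i + (Ω *ᵥ C) i := by
    rw [hΩC, add_zero]
    funext i
    simp
  rw [harg, ← mul_assoc, ← Complex.exp_add]
  congr 2
  simp only [hΩC, add_zero, smul_dotProduct, dotProduct_smul, smul_eq_mul]
  ring

end Literature.Analysis.SpecialFunctions

end
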